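import Summits.QuantumFields.BalabanUV.T4Continuum.Support.NE9ChartFaceOperator
import Summits.QuantumFields.BalabanUV.T4Continuum.Support.NE9CouplingHolomorphyLipschitz

/-!
# NE9ChartFaceCoupling — the NE9 chart face, COUPLING LETTERS BY RESTRICTION (D-8 (vi), option (x)): the chart-level raw kernel of
# record with its coupling-reading letters the real-line RESTRICTIONS of ℂ-disc letters, the restriction identity (res), and the
# LAST-COUPLING LIPSCHITZ MODULUS of every entry from DISPLAYED holomorphy + size on the coupling discs by T8's engine BY NAME
# (cell `pub-balaban`, T4-DAG §2 node U3 ∕ §6 NE9; BINDER row NE9 OWNER lineage `b2b-balaban-t4-ne9-p1`, generation 31; located typing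
# remark R-ne9leaf03g13-1 (t4-ne9-formalise-leaf-03 g13, journal l.15024) booked by the substrate typer as D-8 (vi) (l.15094, «typer
# RECOMMENDS (x)»); the owner's CALL = (x), executed here on `NE9ChartFaceOperator` (p221235))

HONEST FRAMING (T4-DAG PAGE 1).  Rung (B)+1 of the FINITE-VOLUME T⁴ programme — NOT infinite volume, NOT a mass gap, NOT the
Clay problem.  NE9 (`T4OutputRate.NE9` ∧ `FadingMemory`) is a cell NEW ESTIMATE, NOT PRINTED in [I] = [Balaban1987RG1] (CMP **109**),
[II] = [Balaban1988RG2Cluster] (CMP **116**), and NOT PROVED for Bałaban's E^{(j)} («NE9 ⇐ the named binders»; 0∕18 leaves instantiated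
on Bałaban's objects; spine PROVED 0∕9).  HONEST DEPENDENCY (cell line, verbatim): continuum YM on T⁴ ⇐ BetaPertH ∧ nine spine
estimates (0/9 proved); BetaPertH ⇐ (D1) ∧ (D4) ∧ CAP+tail; G-an2-4 gates asym, D1 and NE2/3/4.  `FlowStep.BetaPertH`, (B), (B^μ) do
not occur.  One DATA def + identities + one Cauchy-type bookkeeping inequality over DISPLAYED hypotheses; quotations for TYPES only
(ABSOLUTE RULE); nothing of Bałaban's asserted.  0 sorry.

WHY THIS FILE.  Row NE9's END binder A3 (`hlip ∕ hkerL`: Lipschitz dependence of the species on the LAST coupling) is class K «from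
HOLOMORPHY in g_k» through T8 = `NE9CouplingHolomorphyLipschitz` (engine `norm_sub_le_of_holo_pair′`: a function holomorphic and
bounded by `B` on the discs `|ζ − s| < ϱ`, `|ζ − s′| < ϱ` moves by at most `(2B∕ϱ)·|s − s′|` between the real points).  The substrate's
two-sided record `rawTOfRecord` (p220490) types its coupling-reading letters `pQ pR : ℝ → …` on the REAL line and D-8 (i)–(v)
complexify the BACKGROUND only (leaf-03-g13's located fact).  Option (x), the owner's call: the row INSTANTIATES those parameter slots
by RESTRICTION of ℂ-disc letters — `pQ := fun r => pQᶜ ↑r`, `pR := fun r => pRᶜ ↑r` — at ZERO substrate cost, and DISPLAYS (hol) +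
(size) on the discs as T-rows ([I] p. 263 «C^∞-function of g_{j−1} ∈ [0, γ], (or analytic)», p. 266; (2.12) p. 268 «powers of g_k ×
functions of g_kCB»; [II] p. 6 last ¶, Lemma 2 p. 11); then T8's engine fires AT THE LETTER.  THIS FILE:
* §1 `rawTKernelZ … ζ RS k e` — the chart-level raw kernel with a COMPLEX coupling argument `ζ` in the two potential species (the
  covariance species `covAtT` and the kernel letters `dk`, `gc` are coupling-IDLE, D-6); **`rawTKernel_restrict`** (res): the record's
  kernel with restricted letters IS `rawTKernelZ` at `ζ = ↑(g (k−1))` (`rfl` per species); `rawTKernel_restrict_succ` (output level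
  `k+1` reads `↑(g k)`);
* §2 **`norm_rawTKernel_sub_le_of_holo`**: on a window `W`, from (hol) + (size ≤ B) of the ℂ-letters on the discs of radius `ϱ` about
  the last couplings, EVERY entry of the chart-level raw kernel at output level `k+1` satisfies
  `‖K(g) e − K(g′) e‖ ≤ (2B∕ϱ)·|g k − g′ k|` for `g, g′ ∈ W` (coupling-idle entries: difference `0`); `…_towerPairChart`: the same
  along the cut-off pair chart at every chart point (the form `oRecChart` assembles, p221235).
DISGUISE TEST: one entry, two values of the LAST coupling, hypotheses on the letters only — A3 bookkeeping at the record's letters,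
not NE9 (no history, no table, no recursion).  NOT HERE: the weights ∕ `assemble` normalisation and the activities' response to the
datum (instancer M-rows; NE5 (2.14)–(2.22) TYPE); the quantitative `ϱ, B` (displayed; t-currency c5).

References (TYPES ∕ loci only): [Balaban1987RG1] T. Bałaban, CMP **109** (1987) 249–301, p. 263, p. 266, (2.12) p. 268;
[Balaban1988RG2Cluster] T. Bałaban, CMP **116** (1988) 1–22, p. 6, (1.23) p. 7, Lemma 2 (1.41)–(1.43) p. 11.  Summits-side NEW work
(LEAN PLACEMENT RULE); imports `NE9ChartFaceOperator` (p221235) and `NE9CouplingHolomorphyLipschitz` (T8, p216955) BY NAME;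
modifies nothing.  Value = bookkeeping on the row's instantiation path, NOT summit progress.
-/

noncomputable section

open scoped BigOperators Matrix Matrix.Norms.L2Operator

namespace Summit.QuantumFields.BalabanUV.T4Continuum.NE9ChartFaceCoupling

open Metric Set
open Literature.MathematicalPhysics.QuantumFieldTheory.Balaban1983to89
open Literature.MathematicalPhysics.QuantumFieldTheory.Balaban1983to89.B5Prop11Plancherel (Tor fine)
open Literature.MathematicalPhysics.QuantumFieldTheory.Balaban1983to89.B5G183RateUnitTower (lev)
open Summit.QuantumFields.BalabanUV.T4Continuum.CovariantBlockAveraging (ContourSystem)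
open Summit.QuantumFields.BalabanUV.T4Continuum.B13OpDatum (Species)
open Summit.QuantumFields.BalabanUV.T4Continuum.SubstrateBackgroundTransporters (unitMod)
open Summit.QuantumFields.BalabanUV.T4Continuum.SubstrateTransporterSpecies
open Summit.QuantumFields.BalabanUV.T4Continuum.NE9ChartFaceOperator
open Summit.QuantumFields.BalabanUV.T4Continuum.NE9CouplingHolomorphyLipschitz (norm_sub_le_of_holo_pair')

variable (P : Params) {o : Type} [Fintype o] [DecidableEq o]
  (c : ℂ) (a : ℝ) (s : ℕ → ℂ) (Γ : (k : ℕ) → ContourSystem P.d (lev P.L k) (unitMod P)) {T ι' Ω 𝒴 : Type}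
  (dk : TowerData P o → TowerData P o → ℕ → T → ι' → ι' → ℂ)
  (gc : TowerData P o → TowerData P o → ℕ → T → ((Tor (unitMod P) × Fin P.d) × o) → ι' → ℂ)
  (pQc : ℂ → TowerData P o → TowerData P o → ℕ → Ω → 𝒴 → ((Tor (unitMod P) × Fin P.d) × o) → ((Tor (unitMod P) × Fin P.d) × o) → ℂ)
  (pRc : ℂ → TowerData P o → TowerData P o → ℕ → Ω → 𝒴 → ℂ)

/-! ## §1 The coupling-complexified chart-level kernel and the restriction identity (res) -/

/-- [folklore] DATA: **THE CHART-LEVEL RAW KERNEL WITH A COMPLEX COUPLING ARGUMENT** `ζ` — the two potential species read the ℂ-disc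
letters `pQᶜ ζ`, `pRᶜ ζ`; the covariance species (`covAtT`, p220490) and the kernel letters `dk`, `gc` are coupling-idle (D-6).
[cite: Balaban1987RG1, (2.12) p.268; Balaban1988RG2Cluster, Lemma 2 (1.41)-(1.43) p.11] -/
def rawTKernelZ : ℂ → TowerData P o × TowerData P o → ℕ → Species T ((Tor (unitMod P) × Fin P.d) × o) ι' Ω 𝒴 → ℂ
  | _, RS, k, .cov t b b' => covAtT P c a s Γ RS.1 RS.2 k t b b'
  | _, RS, k, .deltaKer t i j => dk RS.1 RS.2 k t i j
  | _, RS, k, .gammaConstituent t b i => gc RS.1 RS.2 k t b i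
  | ζ, RS, k, .potQ x Y b b' => pQc ζ RS.1 RS.2 k x Y b b'
  | ζ, RS, k, .potR x Y => pRc ζ RS.1 RS.2 k x Y

/-- **(res) THE RESTRICTION IDENTITY**: the record's chart-level kernel with the RESTRICTED letters `pQ := fun r => pQᶜ ↑r`,
`pR := fun r => pRᶜ ↑r` IS the complexified kernel at `ζ = ↑(g (k − 1))` — species by species `rfl`.
[cite: Balaban1988RG2Cluster, (1.23) p.7] -/
theorem rawTKernel_restrict (g : ℕ → ℝ) (RS : TowerData P o × TowerData P o) (k : ℕ)
    (e : Species T ((Tor (unitMod P) × Fin P.d) × o) ι' Ω 𝒴) :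
    rawTKernel P c a s Γ dk gc (fun r => pQc (r : ℂ)) (fun r => pRc (r : ℂ)) g RS k e =
      rawTKernelZ P c a s Γ dk gc pQc pRc ((g (k - 1) : ℝ) : ℂ) RS k e := by
  cases e <;> rfl

/-- [folklore] (res) at output level `k + 1`: the restricted record reads `ζ = ↑(g k)`. -/
theorem rawTKernel_restrict_succ (g : ℕ → ℝ) (RS : TowerData P o × TowerData P o) (k : ℕ)
    (e : Species T ((Tor (unitMod P) × Fin P.d) × o) ι' Ω 𝒴) :
    rawTKernel P c a s Γ dk gc (fun r => pQc (r : ℂ)) (fun r => pRc (r : ℂ)) g RS (k + 1) e =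
      rawTKernelZ P c a s Γ dk gc pQc pRc ((g k : ℝ) : ℂ) RS (k + 1) e := by
  rw [rawTKernel_restrict, Nat.add_sub_cancel]

/-- [folklore] The coupling-idle species do not read `ζ`. -/
theorem rawTKernelZ_idle (ζ ζ' : ℂ) (RS : TowerData P o × TowerData P o) (k : ℕ) :
    (∀ t b b', rawTKernelZ P c a s Γ dk gc pQc pRc ζ RS k (.cov t b b') = rawTKernelZ P c a s Γ dk gc pQc pRc ζ' RS k (.cov t b b')) ∧
    (∀ t i j, rawTKernelZ P c a s Γ dk gc pQc pRc ζ RS k (.deltaKer t i j) =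
      rawTKernelZ P c a s Γ dk gc pQc pRc ζ' RS k (.deltaKer t i j)) ∧
    (∀ t b i, rawTKernelZ P c a s Γ dk gc pQc pRc ζ RS k (.gammaConstituent t b i) =
      rawTKernelZ P c a s Γ dk gc pQc pRc ζ' RS k (.gammaConstituent t b i)) :=
  ⟨fun _ _ _ => rfl, fun _ _ _ => rfl, fun _ _ _ => rfl⟩

/-! ## §2 The last-coupling Lipschitz modulus of every entry from DISPLAYED holomorphy + size (T8's engine by name) -/

/-- **A3 AT THE RECORD'S LETTERS (option (x)).**  On a window `W`, radius `ϱ > 0`, bound `B ≥ 0`: if the ℂ-letters `pQᶜ`, `pRᶜ` at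
the data `RS`, output level `k+1`, are holomorphic and bounded by `B` on the discs `ball ↑(g k) ϱ`, `g ∈ W` (DISPLAYED — TYPE [I]
p. 263 «(or analytic)», (2.12) p. 268; [II] Lemma 2 p. 11), then EVERY entry of the chart-level raw kernel of the restricted record
moves by at most `(2B∕ϱ)·|g k − g′ k|` between two histories `g, g′ ∈ W` (coupling-idle entries: by `0`).  Engine: T8's
`norm_sub_le_of_holo_pair′` BY NAME. [cite: Balaban1987RG1, p.263 and (2.12) p.268; Balaban1988RG2Cluster, Lemma 2 (1.41)-(1.43) p.11] -/
theorem norm_rawTKernel_sub_le_of_holo {W : Set (ℕ → ℝ)} {ϱ B : ℝ} (hϱ : 0 < ϱ) (hB : 0 ≤ B)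
    (RS : TowerData P o × TowerData P o) (k : ℕ)
    (hQhol : ∀ g ∈ W, ∀ (x : Ω) (Y : 𝒴) (b b' : (Tor (unitMod P) × Fin P.d) × o),
      DifferentiableOn ℂ (fun ζ => pQc ζ RS.1 RS.2 (k + 1) x Y b b') (ball ((g k : ℝ) : ℂ) ϱ))
    (hQsize : ∀ g ∈ W, ∀ (x : Ω) (Y : 𝒴) (b b' : (Tor (unitMod P) × Fin P.d) × o),
      ∀ ζ ∈ ball ((g k : ℝ) : ℂ) ϱ, ‖pQc ζ RS.1 RS.2 (k + 1) x Y b b'‖ ≤ B)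
    (hRhol : ∀ g ∈ W, ∀ (x : Ω) (Y : 𝒴), DifferentiableOn ℂ (fun ζ => pRc ζ RS.1 RS.2 (k + 1) x Y) (ball ((g k : ℝ) : ℂ) ϱ))
    (hRsize : ∀ g ∈ W, ∀ (x : Ω) (Y : 𝒴), ∀ ζ ∈ ball ((g k : ℝ) : ℂ) ϱ, ‖pRc ζ RS.1 RS.2 (k + 1) x Y‖ ≤ B) :
    ∀ g ∈ W, ∀ g' ∈ W, ∀ e : Species T ((Tor (unitMod P) × Fin P.d) × o) ι' Ω 𝒴,
      ‖rawTKernel P c a s Γ dk gc (fun r => pQc (r : ℂ)) (fun r => pRc (r : ℂ)) g RS (k + 1) e -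
          rawTKernel P c a s Γ dk gc (fun r => pQc (r : ℂ)) (fun r => pRc (r : ℂ)) g' RS (k + 1) e‖ ≤
        2 * B / ϱ * |g k - g' k| := by
  intro g hg g' hg' e
  have hnn : 0 ≤ 2 * B / ϱ * |g k - g' k| := mul_nonneg (div_nonneg (by linarith) hϱ.le) (abs_nonneg _)
  rw [rawTKernel_restrict_succ, rawTKernel_restrict_succ]
  cases e with
  | cov t b b' => simpa [rawTKernelZ] using hnn
  | deltaKer t i j => simpa [rawTKernelZ] using hnn
  | gammaConstituent t b i => simpa [rawTKernelZ] using hnn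
  | potQ x Y b b' =>
    exact norm_sub_le_of_holo_pair' (Φ := fun ζ => pQc ζ RS.1 RS.2 (k + 1) x Y b b') hϱ (hQsize g hg x Y b b')
      (hQhol g' hg' x Y b b') (hQsize g' hg' x Y b b')
  | potR x Y =>
    exact norm_sub_le_of_holo_pair' (Φ := fun ζ => pRc ζ RS.1 RS.2 (k + 1) x Y) hϱ (hRsize g hg x Y) (hRhol g' hg' x Y)
      (hRsize g' hg' x Y)

/-- **THE SAME ALONG THE CUT-OFF PAIR CHART** (the data `oRecChart` assembles, p221235): at every chart point `A`, with the letters'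
(hol) + (size) DISPLAYED at the data `towerPairChart R⁰ ρ A`. [cite: Balaban1988RG2Cluster, Lemma 2 (1.41)-(1.43) p.11] -/
theorem norm_rawTKernel_sub_le_of_holo_towerPairChart {W : Set (ℕ → ℝ)} {ϱ B : ℝ} (hϱ : 0 < ϱ) (hB : 0 ≤ B)
    (R₀ : TowerData P o) (ρ : ℝ) (A : TowerData P o) (k : ℕ)
    (hQhol : ∀ g ∈ W, ∀ (x : Ω) (Y : 𝒴) (b b' : (Tor (unitMod P) × Fin P.d) × o),
      DifferentiableOn ℂ (fun ζ => pQc ζ (towerPairChart P R₀ ρ A).1 (towerPairChart P R₀ ρ A).2 (k + 1) x Y b b')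
        (ball ((g k : ℝ) : ℂ) ϱ))
    (hQsize : ∀ g ∈ W, ∀ (x : Ω) (Y : 𝒴) (b b' : (Tor (unitMod P) × Fin P.d) × o), ∀ ζ ∈ ball ((g k : ℝ) : ℂ) ϱ,
      ‖pQc ζ (towerPairChart P R₀ ρ A).1 (towerPairChart P R₀ ρ A).2 (k + 1) x Y b b'‖ ≤ B)
    (hRhol : ∀ g ∈ W, ∀ (x : Ω) (Y : 𝒴),
      DifferentiableOn ℂ (fun ζ => pRc ζ (towerPairChart P R₀ ρ A).1 (towerPairChart P R₀ ρ A).2 (k + 1) x Y)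
        (ball ((g k : ℝ) : ℂ) ϱ))
    (hRsize : ∀ g ∈ W, ∀ (x : Ω) (Y : 𝒴), ∀ ζ ∈ ball ((g k : ℝ) : ℂ) ϱ,
      ‖pRc ζ (towerPairChart P R₀ ρ A).1 (towerPairChart P R₀ ρ A).2 (k + 1) x Y‖ ≤ B) :
    ∀ g ∈ W, ∀ g' ∈ W, ∀ e : Species T ((Tor (unitMod P) × Fin P.d) × o) ι' Ω 𝒴,
      ‖rawTKernel P c a s Γ dk gc (fun r => pQc (r : ℂ)) (fun r => pRc (r : ℂ)) g (towerPairChart P R₀ ρ A) (k + 1) e -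
          rawTKernel P c a s Γ dk gc (fun r => pQc (r : ℂ)) (fun r => pRc (r : ℂ)) g' (towerPairChart P R₀ ρ A) (k + 1) e‖ ≤
        2 * B / ϱ * |g k - g' k| :=
  norm_rawTKernel_sub_le_of_holo P c a s Γ dk gc pQc pRc hϱ hB (towerPairChart P R₀ ρ A) k hQhol hQsize hRhol hRsize

end Summit.QuantumFields.BalabanUV.T4Continuum.NE9ChartFaceCoupling

end
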